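import Literature.MathematicalPhysics.QuantumFieldTheory.Balaban1983to89.Beta.WoodburyCovariant
import Literature.MathematicalPhysics.QuantumFieldTheory.Balaban1983to89.B5DeltaA169

/-!
# Beta / VectorPropagatorDict — the DICT ROW: Bałaban's covariant vector-field propagator `G_k(U = 1) = Δ_a⁻¹`
of (1.69)–(1.73)/(1.83) against the direct sum `⊕_μ Γ_μ` of the scalar bond-covariance kernels of
`Beta/WoodburyCovariant` — EXACT IDENTITIES in position space and on the alias fibres, no bounds

HONEST FRAMING (verbatim, page 1 of everything this cell writes): discharging `BetaPertH` makes Bałaban's UV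
stability UNCONDITIONAL — a real constructive-QFT result; it is NOT the continuum limit and NOT the Clay problem.
ABSOLUTE RULE (verbatim): no internally-minted statement may enter as a cited fact.  Every hypothesis is either
kernel-proved in this package or a verbatim quotation of a PUBLISHED theorem with page reference; the manuscripts under
audit are NOT citable for their own disputed steps, programme-internal claims never.  THIS MODULE quotes nothing as a
hypothesis: every statement below is a Mathlib-elementary theorem (finite complex matrices: block-diagonal algebra,
uniqueness of inverses, the Woodbury identity `Matrix.add_mul_mul_inv_eq_sub`, `det (1 − AB) = det (1 − BA)`) about
objects ALREADY TYPED in the tree from the printed definitions — `B5Block118.QvOp`/`QsOp` (1.18)/(1.20),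
`B5Action121.GradOp` (1.4), `B5Prop11Lower.Lap` (1.21), `B5Value126.PcT` (1.26)/(1.70), `B5DeltaA169.DeltaA`/`QvAdj`
(1.69)/(1.73), `B5Prop11Plancherel.calG`/`dftV`/`blocks` (1.83), `B5Prop11Inverse.Dmat`/`Omat`/`bv`/`Da₀`/`G₀`,
`Beta.WoodburyCovariant.covOp`/`gram`/`bondAvg`/`wt`/`GdecW` — and the `[Balaban1984PropagatorsI …]` tags below locate
the printed DEFINITIONS / displays each identity transcribes (context, not hypotheses).

WHY (BETA-SPEC v1.9r §7.20 (d) «G-beta-21 UPTAKE», LEMMAS row BETA-DICT, GAPS G-beta-21; `Beta/WoodburyCovariant` header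
«WHAT IT DOES NOT GIVE (ii)»).  The window legs (W2′)₀/(W3a)₀ of the composed road are kernel for a SCALAR `U = 1` MODEL:
one component `A_μ`, operator `A_{B_μ} = n²(−Δ₁) + a·n^d B_μᵀB_μ`, `B_μ = bondAvg μ`, inverse
`Γ_μ = GdecW (wt B_μ) a 0 = G^⊥_free,0 + |𝕋|⁻¹a⁻¹ − R^⊥_{u·v_μ,0}` (`bondInv_decomposition`).  They «MUST NOT be described as
kernel for Bałaban's covariant propagator until the DICT ROW is a kernel statement: the vector/covariant G_k(U = 1) of B5
(1.23)–(1.31)» — the matrix problem on vector functions with the gauge-fixing quadratic form, whose components are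
coupled through the projection `P` of (1.26)–(1.28)/(1.70), «NOT ⊕_μ of scalar problems», in momentum space on the alias
fibres (1.29)–(1.31).  THIS FILE IS THAT DICTIONARY, as equalities of matrices: it says exactly which part of
`G_k(U = 1)` the direct sum `⊕_μ Γ_μ` IS (the «Δ + aQ*Q»-inverse = lines 1–2 of (1.83), every fibre incl. `p′ = 0`) and
exhibits the remainder exactly (the longitudinal line 3 of (1.83) = a Woodbury correction through `∂P`).  No estimate
of the remainder is made or needed for these statements; none is claimed.

SOURCE.  B5 = T. Bałaban, *Propagators and renormalization transformations for lattice gauge theories. I*, Commun. Math.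
Phys. **95** (1984) 17–40 (`Balaban1984PropagatorsI`); renders `b2b-balaban-ref1/pages/1984-cmp95-propagators-rt-I/
…-p004,p005,p006,p007,p011,p013,p014,p015-x2.png` (journal pp. 20, 21, 22, 23, 27, 29, 30, 31) read as images this session.
THE PRINTED TEXT (verbatim):
* p.20 (1.18): «(Q_kA)_b = Σ_{x∈B^k(b₋)} η^{d+1} A([x, x(b)]), b ⊂ T₁^{(k)} = ℤ^d ∩ T_η, η = L^{−k}, (1.18) and x(b) is a
  point in B^k(b₊) obtained from x by translation by b. If b = ⟨y, y + e_μ⟩, then x(b) = x + e_μ.»; (1.20): «Under a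
  gauge transformation λ the field A and the averaged field Q_kA transform as follows A^λ = A − ∂^ηλ, (Q_kA^λ)_b =
  (Q_kA)_b − (Σ_{x∈B^k(b₊)} η^dλ(x) − Σ_{x∈B^k(b₋)} η^dλ(x)), b ⊂ T₁^{(k)}, (1.20) or denoting (Q′_kλ)(y) = Σ_{x∈B^k(y)}
  η^dλ(x), we have Q_kA^λ = Q_kA − ∂Q′_kλ.»
* p.21 (1.21): «⟨∂A, ∂A⟩ = ½ Σ_{x∈T_η,μ,ν} η^d|F_{μν}(x)|² = … = Σ_μ⟨A_μ, ΔA_μ⟩ − ⟨∂*A, ∂*A⟩, (1.21) where Δ is η-lattice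
  Laplace operator for scalar functions and ∂* is the divergence operator for vector functions, ∂*A = Σ_μ ∂*_μA_μ.»
* p.22: «Hence it is an invertible operator and by Δ⁻¹ we denote its inverse on this subspace. We extend it to the
  whole space by linearity, putting its value on constant functions equal to 0.»; (1.26): «The value of the infimum is
  equal to ½‖∂*A − Δλ₀‖² = ½‖Δ⁻¹Q′*_k(Q′_kΔ⁻²Q′*_k)⁻¹Q′_kΔ⁻¹∂*A‖² = ½⟨∂*A, Δ⁻¹Q′*_k(Q′_kΔ⁻²Q′*_k)⁻¹Q′_kΔ⁻¹∂*A⟩, (1.26)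
  where we have used the fact that the quadratic form in ∂*A is defined by a projection operator.»; before (1.28): «It
  is easy to verify that the operator I − Δ⁻¹Q′*_k(Q′_kΔ⁻²Q′*_k)⁻¹Q′_kΔ⁻¹ is a projection in the space L²(T_η) of
  scalar functions».
* p.23 (1.29): «f̃(p) = Σ_{x∈T′_η} η^d e^{−ip·x} f(x), p ∈ T̃′_η»; (1.31): «Δ(p) = Σ_{μ=1}^d |∂_μ(p)|², ∂_μ(p) =
  (e^{iηp_μ} − 1)/η, u_k(p) = Π_{μ=1}^d ∂¹_μ(p′)/∂_μ(p), (1.31)»; «p ∈ T̃_η is represented as a sum p = p′ + l,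
  p′ ∈ T̃₁^{(k)} and l = (l₁, …, l_d), l_μ = 2πm_μ, m_μ is an integer».
* p.27 (1.55): «using the identity Q_k∂ = ∂₁Q′_k, (1.55) ∂₁ is the unit lattice differentiation».
* p.29 (1.69): «⟨A, Δ_aA⟩ = ⟨A, ∂*∂A⟩ + ⟨A, ∂R∂*A⟩ + a⟨A, Q*QA⟩ = ⟨A, ΔA⟩ − ⟨A, ∂P∂*A⟩ + a⟨A, Q*QA⟩, (1.69)
  Δ = ∂*∂ + ∂∂*, R = I − P,».
* p.30 (1.70)/(1.71): «The configuration ∂*A is orthogonal to constant functions and on such configurations the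
  operator P is given by the formula P = Δ⁻¹Q′*(Q′Δ⁻²Q′*)⁻¹Q′Δ⁻¹. (1.70) We will obtain an explicit representation of
  Δ_a⁻¹ = G_k, or simply G. (1.71)»; (1.73): «It is an invertible operator and the equation ΔA −
  ∂Δ⁻¹Q′*(Q′Δ⁻²Q′*)⁻¹Q′Δ⁻¹∂*A + aQ*QA = J (1.73) has a unique solution for the arbitrary vector function J.»
* p.31 (1.83) (quoted in full in `B5Prop11Bound`; typed there as `Fiber.G`, `G₀`): «Ã_μ(p′+l) = (GJ)~_μ(p′+l) =
  (1/Δ(p′+l)) J̃_μ(p′+l) − a conj[u(p′+l)v_μ(p′+l)]/Δ(p′+l) φ_μ⁻¹(p′) Σ_{l′} u(p′+l′)v_μ(p′+l′)/Δ(p′+l′) J̃_μ(p′+l′)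
  + [ … ] a⁻¹(Σ_λ |∂_{1,λ}(p′)|²/φ_λ(p′))⁻¹ · Σ_{l′,ν}[ … ] J̃_ν(p′+l′), (1.83) for p′ ≠ 0, Ã_μ(l) = (1/Δ(l)) J̃_μ(l),
  Ã_μ(0) = a⁻¹J̃_μ(0), where φ_μ(p′) = 1 + aΣ_{l″}|u(p′+l″)|²|v_μ(p′+l″)|²/Δ(p′+l″) for p′ ≠ 0. (1.84)» — LINE 1 = the
  diagonal `1/Δ`, LINE 2 = the `μ`-diagonal rank-one term with `φ_μ`, LINE 3 = the `a⁻¹(Σ_λ…)⁻¹ [..][..]^*` term, the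
  only one mixing `μ ≠ ν` (pass 5 `B5Prop11Inverse.G_eq`: `G = Omat + cT • b b^*`).

SETTING.  Any `d`, fine torus `T_η = Tor (fine n M)` (`η = 1/n`, any `n ≥ 1`, periods `n·M_μ`, any `M_μ ≥ 1`), coarse
(unit) torus `Tor M`; vector functions `A : Tor (fine n M) × Fin d → ℂ`; `a : ℝ` (`a > 0` where an inverse occurs);
King scaling `c = η⁻² = n²`, mass `0`.  `covSum a := ⊕_μ (covOp n M (bondAvg μ) a n² 0)` (complexified),
`gammaSum a := ⊕_μ GdecW n M (wt (bondAvg μ)) a 0`, `dP := GradOp (fine n M) n * PcT n M n` (`= ∂P`),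
`capacitance := 1 − (∂P)ᴴ(⊕Γ)(∂P)` (scalar functions); `⊕_μ` = `Matrix.blockDiagonal` over the component index.

WHAT THIS FILE GIVES (zero `sorry`; axioms `propext`, `Classical.choice`, `Quot.sound`).
* (D1) §2 **`Lap_add_QQ_eq_covSum`: `Lap n M + a•(QvAdj n M * QvOp n M) = covSum n M a`** — the «Δ + aQ*Q» part of `Δ_a`
  (1.69)/(1.73) IS, entry by entry, the direct sum over `μ` of the scalar bond operators `A_{B_μ}` of
  `WoodburyCovariant` §10 with the SAME `a`.  Ingredients: `Lap_eq_blockDiagonal` («Δ is η-lattice Laplace operator for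
  scalar functions» componentwise (1.21): `Lap = ⊕_μ lapF (fine n M) n² 0`), `QvAdj_mul_QvOp_eq_blockDiagonal`
  (`Q*_kQ_k = ⊕_μ n^d B_μᵀB_μ = ⊕_μ gram B_μ`: at `U = 1` the bond average of direction `μ` sees only `A_μ`, (1.18),
  `QvOp_apply_of_ne`; `B_μ = bondAvg μ` is the `(μ,μ)` block of `QvOp`, `WoodburyCovariant.bondAvg_eq_QvOp`).
* (D2) §2/§5 **`DeltaA_eq_covSum_sub_dP`: `DeltaA n M a = covSum n M a − dP·dPᴴ`**, `dP_mul_conjTranspose`: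
  `(∂P)(∂P)ᴴ = ∂P∂ᴴ` (`P` Hermitian idempotent — «is a projection», p.22; `PcT_conjTranspose`, `PcT_mul_PcT`).  So the
  ONLY coupling between components in `Δ_a` (hence in `G_k(U = 1)`) is the gauge-sector term `∂P∂*` of (1.69), which
  factors through SCALAR functions.
* (D3) §3 **`inv_Lap_add_QQ`: `(Lap + a•Q*_kQ_k)⁻¹ = gammaSum n M a`** (`a > 0`, `n ≥ 1`), `gammaSum_apply`:
  `(⊕Γ)((x,μ),(x′,ν)) = δ_{μν}·(GfreePerp n M 0 (x′−x) + |𝕋|⁻¹a⁻¹ − RperpW (wt B_μ) a 0 x x′)` — the massless endpoint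
  decomposition (P0₀) of `WoodburyCovariant` (`GdecW_mul_covOp_zero` with `covariant_bondAvg`, `admissible_bondAvg`),
  component by component (`gammaSum_mul_covSum`, `covSum_mul_gammaSum`, `isUnit_covSum`).
* (D4) §5 **`calG_eq_gammaSum_add_resolvent`: `calG = ⊕Γ + calG·(∂P)(∂P)ᴴ·(⊕Γ)`** (and `…_resolvent'` from the other
  side), from `DeltaA_mul_gammaSum : Δ_a·(⊕Γ) = 1 − (∂P)(∂P)ᴴ(⊕Γ)` and the lineage's `calG·Δ_a = 1`
  (`B5DeltaA169.calG_mul_DeltaA`; `calG = Δ_a⁻¹` is `B5DeltaA169.calG_eq_DeltaA_inv`, «Δ_a⁻¹ = G_k» (1.71));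
  **`calG_eq_gammaSum_add_woodbury`: `calG = ⊕Γ + (⊕Γ)(∂P)·capacitance⁻¹·(∂P)ᴴ(⊕Γ)`** with `isUnit_capacitance`
  (`det capacitance ≠ 0` ⇐ `DeltaA_eq_factor : Δ_a = (⊕A_{B_μ})·(1 − (⊕Γ)(∂P)(∂P)ᴴ)`, `isUnit_DeltaA`,
  `Matrix.det_one_sub_mul_comm`) — every inverse written is certified to exist.
* (D5) §4 **`QvOp_mul_GradOp`: `QvOp n M * GradOp (fine n M) n = GradOp M 1 * QsOp n M`** — (1.55) «Q_k∂ = ∂₁Q′_k» at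
  `U = 1` as a matrix identity (from the lineage's typed gauge covariance (1.20), `B5Block118.QvOp_gaugeT_eq`).
* (D6) §6, MOMENTUM SPACE on the alias fibres `p = p′ + l` ((1.29)–(1.31); `U = dftV (fine n M)`, fibres
  `B5FiberQQ.fiberAt q`, `q = p′ ∈ Tor M`):  `covSum_eq_conj : ⊕A_{B_μ} = U^*·𝓜̂·U`, blocks `MBlocks q` =
  `Dmat (fiberAt q)` («Δ + aQ*Q» on the fibre, pass 5) at `p′ ≠ 0`, `DaBlocks 0 = Da₀` at `p′ = 0` (`fiber_covSum`);
  **`gammaSum_eq_conj : ⊕Γ = U^*·𝓞̂·U`, blocks `OBlocks q` = `Omat (fiberAt q)` = «⊕_μ[Δ⁻¹ − aφ_μ⁻¹x_μx_μ^*]» = LINES 1–2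
  of (1.83) at `p′ ≠ 0`, and `blocks 0 = G₀` (the full zero fibre of (1.83)) at `p′ = 0`** (`MBlocks_mul_OBlocks` +
  uniqueness of the inverse); `calGhat_eq : Ĝ = 𝓞̂ + 𝓛̂`, `LBlocks q = cT • b b^*` = LINE 3 of (1.83) at `p′ ≠ 0`, `0` at
  `p′ = 0` (pass 5 `G_eq`); MAIN **`calG_eq_gammaSum_add_longitudinal : calG n hn M a ha = gammaSum n M a +
  U^*·𝓛̂·U`** and **`longitudinal_eq : (⊕Γ)(∂P)·capacitance⁻¹·(∂P)ᴴ(⊕Γ) = U^*·𝓛̂·U`**.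
  READING: the scalar `U = 1` kernels `Γ_μ` behind (W2′)₀/(W3a)₀ ARE, fibre by fibre and component by component, the
  first two lines of Bałaban's (1.83) for `G_k(U = 1)` (plus the whole `p′ = 0` fibre), and `G_k(U = 1) − ⊕_μΓ_μ` IS the
  third line = the Woodbury correction through `∂P` — an identity of matrices, in position space AND in momentum space.

WHAT IT DOES NOT GIVE (located, not claimed).  (i) NO BOUND of any kind on the longitudinal term `U^*𝓛̂U` /
`capacitance⁻¹` / `cT`, and NO statement that `G_k(U = 1) ≈ ⊕_μΓ_μ` in any norm — the longitudinal (gauge) sector is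
massless and its contribution is not small; the operator-norm bounds of `Ĝ` are pass 4's (`B5Prop11Plancherel`), the
decay (1.90) is nobody's here.  Whether a window leg needs line 3 at all, and with which estimate, is the assembly
owner's call (`ComposedRoad`, GAPS) — this file only makes the identification exact.  (ii) `U = 1` only (`Q_k(U)`,
`U ≠ 1`, is not coarse-covariant; untouched).  (iii) Nothing about (1.22)–(1.28) as Gaussian/Faddeev–Popov integral
manipulations: `P` enters as the typed matrix `PcT` = the operator printed in (1.26)/(1.70) (its typing is
`B5Value126`'s, its identification inside `Δ_a` is `B5DeltaA169`'s).  (iv) (W2′)₀/(W3a)₀ remain statements about the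
scalar model; this file supplies the kernel sentence «`Γ_μ` = lines 1–2 of (1.83), component `μ`» that G-beta-21 asks
for before any covariant wording — it does not itself re-label those legs.  (v) The torus-entry `(x,x′) ↦ Pt`-family
dictionary for `window_of_scaleFamily` (ComposedRoad v1.4 §9) is NOT here (handed on, AN5.md §11).  (vi) Nothing about
`C_k`, far regions, `β`, `κ_Bal` or its sign, table identification; no continuum statement of any kind.
Cell records: BETA-SPEC v1.9r §7.20 (d); LEMMAS.md row BETA-DICT; GAPS G-beta-21; AN5.md §11.  Unit
`b2b-balaban-beta-an5-g7` (DEDICATED β sub-cell row BETA-an5, gen 7; journal node BETA-an5-g7-VECTOR-DICT); staged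
byte-identically under `HOME/lean/BalabanYm4/`.  Value = kernel dictionary between two already-typed finite-matrix
objects, NOT summit progress.
-/

noncomputable section

open Finset
open Matrix hiding comp gram
open scoped BigOperators ComplexConjugate Matrix

namespace Literature.MathematicalPhysics.QuantumFieldTheory.Balaban1983to89.Beta.VectorPropagatorDict

open Literature.MathematicalPhysics.QuantumFieldTheory.King1986.Torus (lapF)
open Literature.MathematicalPhysics.QuantumFieldTheory.Balaban1983to89.B5Prop11Plancherel
open Literature.MathematicalPhysics.QuantumFieldTheory.Balaban1983to89.B5Prop11Inverse
open Literature.MathematicalPhysics.QuantumFieldTheory.Balaban1983to89.B5Prop11Lower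
open Literature.MathematicalPhysics.QuantumFieldTheory.Balaban1983to89.B5Action121
open Literature.MathematicalPhysics.QuantumFieldTheory.Balaban1983to89.B5Block118
open Literature.MathematicalPhysics.QuantumFieldTheory.Balaban1983to89.B5Value126
open Literature.MathematicalPhysics.QuantumFieldTheory.Balaban1983to89.B5DeltaA169
open Literature.MathematicalPhysics.QuantumFieldTheory.Balaban1983to89.Beta.WoodburyCovariant
open Literature.MathematicalPhysics.QuantumFieldTheory.Balaban1983to89.Beta.WoodburyFibre (GfreePerp)

/-! ## §1 Tools: componentwise actions on vector functions `A : T × {1..d} → ℂ` -/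

section Tools

variable {d : ℕ} (N : Fin d → ℕ) [hN : ∀ μ, NeZero (N μ)]

omit hN in
/-- two rectangular complex matrices agree if they agree on every vector. [folklore] -/
theorem ext_of_mulVec' {m k : Type*} [Fintype k] [DecidableEq k] {A B : Matrix m k ℂ}
    (h : ∀ v, A *ᵥ v = B *ᵥ v) : A = B :=
  Matrix.toLin'.injective (LinearMap.ext fun v => by rw [Matrix.toLin'_apply, Matrix.toLin'_apply, h v])

/-- a block-diagonal (in the component index) operator acts componentwise:
`((⊕_μ C_μ) A)_μ = C_μ A_μ`. [folklore] -/
theorem blockDiagonal_mulVec_apply (C : Fin d → Matrix (Tor N) (Tor N) ℂ) (A : Tor N × Fin d → ℂ)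
    (x : Tor N) (μ : Fin d) :
    (Matrix.blockDiagonal C *ᵥ A) (x, μ) = (C μ *ᵥ comp N A μ) x := by
  simp only [Matrix.mulVec, dotProduct, Fintype.sum_prod_type, Matrix.blockDiagonal_apply', ite_mul,
    zero_mul, comp, Finset.sum_ite_eq, Finset.mem_univ, if_true]

omit hN in
/-- entries of `S_ν^*` (vector-index translation by `−e_ν`). [folklore] -/
theorem shiftM_conjTranspose_apply (ν : Fin d) (i j : Tor N × Fin d) :
    (shiftM N ν)ᴴ i j = if j = (i.1 - unitVec N ν, i.2) then 1 else 0 := by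
  rw [Matrix.conjTranspose_apply, shiftM]
  have h : (i = (j.1 + unitVec N ν, j.2)) ↔ (j = (i.1 - unitVec N ν, i.2)) := by
    constructor
    · rintro rfl
      simp
    · rintro rfl
      simp
  by_cases hj : j = (i.1 - unitVec N ν, i.2)
  · rw [if_pos hj, if_pos (h.mpr hj), star_one]
  · rw [if_neg hj, if_neg (fun h' => hj (h.mp h')), star_zero]

/-- `(S_ν^* A)_κ(x) = A_κ(x − e_ν)`. [folklore] -/
theorem shiftM_conjTranspose_mulVec (ν : Fin d) (A : Tor N × Fin d → ℂ) (x : Tor N) (κ : Fin d) :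
    ((shiftM N ν)ᴴ *ᵥ A) (x, κ) = A (x - unitVec N ν, κ) := by
  simp only [Matrix.mulVec, dotProduct, shiftM_conjTranspose_apply, boole_mul, Finset.sum_ite_eq',
    Finset.mem_univ, if_true]

/-- the adjoint vector-index difference acts componentwise: `(∇_ν^* A)_κ = ∂_ν^* A_κ`. [folklore] -/
theorem fdiff_conjTranspose_mulVec_apply (c : ℂ) (ν : Fin d) (A : Tor N × Fin d → ℂ) (x : Tor N)
    (κ : Fin d) : ((fdiff N c ν)ᴴ *ᵥ A) (x, κ) = ((sdiff N c ν)ᴴ *ᵥ comp N A κ) x := by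
  rw [sdiff_conjTranspose_mulVec]
  simp only [fdiff, Matrix.conjTranspose_smul, Matrix.conjTranspose_sub, Matrix.conjTranspose_one,
    Matrix.smul_mulVec, Matrix.sub_mulVec, Matrix.one_mulVec, Pi.smul_apply, Pi.sub_apply,
    shiftM_conjTranspose_mulVec, smul_eq_mul, Complex.star_def, comp]

/-- `(∇_ν A)_κ = ∂_ν A_κ` as functions. [folklore] -/
theorem comp_fdiff_mulVec (c : ℂ) (ν : Fin d) (A : Tor N × Fin d → ℂ) (κ : Fin d) :
    comp N (fdiff N c ν *ᵥ A) κ = sdiff N c ν *ᵥ comp N A κ :=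
  funext fun y => fdiff_mulVec_apply N c ν A y κ

/-- King's `c·(−Δ)` (`lapF`, real entries, `m² = 0`) applied to a COMPLEX function:
`Σ_{z′} lapF(x,z′) f(z′) = 2dc·f(x) − c Σ_μ (f(x+e_μ) + f(x−e_μ))`. [folklore] -/
theorem lapF_map_mulVec (c : ℝ) (f : Tor N → ℂ) (x : Tor N) :
    ((lapF N c 0).map Complex.ofRealHom *ᵥ f) x
      = 2 * (d : ℂ) * (c : ℂ) * f x - (c : ℂ) * ∑ μ : Fin d, (f (x + unitVec N μ) + f (x - unitVec N μ)) := by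
  have h1 : ∀ z' : Tor N,
      (((lapF N c 0) x z' : ℝ) : ℂ) * f z'
        = (if z' = x then 2 * (d : ℂ) * (c : ℂ) * f z' else 0)
          - ∑ μ : Fin d, ((if z' = x + unitVec N μ then (c : ℂ) * f z' else 0)
              + (if z' = x - unitVec N μ then (c : ℂ) * f z' else 0)) := by
    intro z'
    simp only [lapF, zero_add, Complex.ofReal_sub, Complex.ofReal_mul, Complex.ofReal_sum,
      Complex.ofReal_add, apply_ite Complex.ofReal, Complex.ofReal_one, Complex.ofReal_zero,
      Complex.ofReal_natCast, Complex.ofReal_ofNat, sub_mul, Finset.mul_sum, Finset.sum_mul, mul_add,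
      add_mul]
    congr 1
    · split_ifs <;> ring
    · refine Finset.sum_congr rfl fun μ _ => ?_
      split_ifs <;> ring
  simp only [Matrix.mulVec, dotProduct, Matrix.map_apply, Complex.ofRealHom_eq_coe, h1,
    Finset.sum_sub_distrib, Finset.sum_ite_eq', Finset.mem_univ, if_true]
  congr 1
  rw [Finset.sum_comm]
  simp only [Finset.sum_add_distrib, Finset.sum_ite_eq', Finset.mem_univ, if_true, Finset.mul_sum, mul_add]

end Tools

/-! ## §2 `Δ + aQ*_kQ_k` of (1.69) IS the direct sum over components of the bond covariance operators -/

section DirectSum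

variable {d : ℕ} (n : ℕ) [NeZero n] (M : Fin d → ℕ) [hM : ∀ μ, NeZero (M μ)]

/-- `Δ A` componentwise: `(ΔA)_κ = Δ A_κ` with `Δ = Σ_ν ∂_ν^*∂_ν` the scalar `η`-lattice Laplace operator,
`η = 1/n` ((1.21) «Δ is η-lattice Laplace operator for scalar functions»). [cite: Balaban1984PropagatorsI, (1.21) p.21] -/
theorem Lap_mulVec_apply (A : Tor (fine n M) × Fin d → ℂ) (x : Tor (fine n M)) (κ : Fin d) :
    (Lap n M *ᵥ A) (x, κ) = (LapS (fine n M) (n : ℂ) *ᵥ comp (fine n M) A κ) x := by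
  simp only [Lap, LapS, Matrix.sum_mulVec, Finset.sum_apply, ← Matrix.mulVec_mulVec,
    fdiff_conjTranspose_mulVec_apply, comp_fdiff_mulVec]

/-- **`Δ` of (1.21)/(1.69) on vector functions = `⊕_μ n²(−Δ_{T_η})` = the direct sum of `d` copies of King's
`lapF (fine n M) (n²) 0`** (King scaling `c = η⁻² = n²`, massless). [folklore] -/
theorem Lap_eq_blockDiagonal :
    Lap n M = Matrix.blockDiagonal fun _ : Fin d => (lapF (fine n M) ((n : ℝ) ^ 2) 0).map Complex.ofRealHom := by
  refine ext_of_mulVec fun A => funext fun ⟨x, κ⟩ => ?_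
  rw [Lap_mulVec_apply, blockDiagonal_mulVec_apply, lapF_map_mulVec, LapS_mulVec]
  simp only [map_natCast, Complex.ofReal_pow, Complex.ofReal_natCast]
  rw [Finset.mul_sum]
  have hc : 2 * (d : ℂ) * (n : ℂ) ^ 2 * comp (fine n M) A κ x
      = ∑ _ν : Fin d, (n : ℂ) ^ 2 * (2 * comp (fine n M) A κ x) := by
    rw [Finset.sum_const, Finset.card_univ, Fintype.card_fin, nsmul_eq_mul]
    ring
  rw [hc, ← Finset.sum_sub_distrib]
  refine Finset.sum_congr rfl fun ν _ => ?_
  ring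

omit [NeZero n] hM in
/-- `Q_k` couples no components: `(Q_k)_{(y,κ),(z,μ′)} = 0` for `κ ≠ μ′` ((1.18): the average over bonds of
direction `κ` sees only `A_κ`). [cite: Balaban1984PropagatorsI, (1.18) p.20] -/
theorem QvOp_apply_of_ne (y : Tor M) (κ : Fin d) (z : Tor (fine n M)) (μ' : Fin d) (h : κ ≠ μ') :
    QvOp n M (y, κ) (z, μ') = 0 := by
  unfold QvOp
  exact if_neg fun h' => h h'.symm

omit [NeZero n] in
/-- entries of `(Q_k)ᴴQ_k`: `δ_{μν} Σ_y (bondAvg μ)(y,x)(bondAvg μ)(y,x′)`. [folklore] -/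
theorem conjTranspose_QvOp_mul_QvOp_apply (x x' : Tor (fine n M)) (μ ν : Fin d) :
    ((QvOp n M)ᴴ * QvOp n M) (x, μ) (x', ν)
      = if μ = ν then ∑ y : Tor M, (((bondAvg n M μ y x * bondAvg n M μ y x' : ℝ)) : ℂ) else 0 := by
  rw [Matrix.mul_apply, Fintype.sum_prod_type]
  by_cases h : μ = ν
  · subst h
    rw [if_pos rfl]
    refine Finset.sum_congr rfl fun y _ => ?_
    rw [Finset.sum_eq_single μ]
    · rw [Matrix.conjTranspose_apply, ← bondAvg_eq_QvOp, ← bondAvg_eq_QvOp, Complex.star_def,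
        Complex.conj_ofReal, Complex.ofReal_mul]
    · intro κ _ hκ
      rw [QvOp_apply_of_ne n M y κ x' μ hκ, mul_zero]
    · intro hμ
      exact absurd (Finset.mem_univ μ) hμ
  · rw [if_neg h]
    refine Finset.sum_eq_zero fun y _ => Finset.sum_eq_zero fun κ _ => ?_
    by_cases hκ : κ = μ
    · subst hκ
      rw [QvOp_apply_of_ne n M y κ x' ν h, mul_zero]
    · rw [Matrix.conjTranspose_apply, QvOp_apply_of_ne n M y κ x μ hκ, star_zero, zero_mul]

omit [NeZero n] in
/-- entries of the gram matrix `n^d BᵀB`. [folklore] -/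
theorem gram_apply (B : Matrix (Tor M) (Tor (fine n M)) ℝ) (x x' : Tor (fine n M)) :
    gram n M B x x' = (n : ℝ) ^ d * ∑ y, B y x * B y x' := by
  simp only [gram, Matrix.smul_apply, Matrix.mul_apply, Matrix.transpose_apply, smul_eq_mul]

omit [NeZero n] in
/-- **`Q*_kQ_k` of (1.69) = `⊕_μ n^d (bondAvg μ)ᵀ(bondAvg μ)` = the direct sum of the gram matrices of the
covariant bond averages** (`Q*_k = η^{-d}(Q_k)ᴴ`, `QvAdj`). [folklore] -/
theorem QvAdj_mul_QvOp_eq_blockDiagonal :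
    QvAdj n M * QvOp n M = Matrix.blockDiagonal fun μ => (gram n M (bondAvg n M μ)).map Complex.ofRealHom := by
  ext ⟨x, μ⟩ ⟨x', ν⟩
  rw [QvAdj, Matrix.smul_mul, Matrix.smul_apply, smul_eq_mul, conjTranspose_QvOp_mul_QvOp_apply,
    Matrix.blockDiagonal_apply']
  by_cases h : μ = ν
  · subst h
    rw [if_pos rfl, if_pos rfl, Matrix.map_apply, Complex.ofRealHom_eq_coe, gram_apply]
    push_cast
    rfl
  · rw [if_neg h, if_neg h, mul_zero]

/-- THE DIRECT SUM `⊕_μ A_{B_μ}` of an5-g6's bond covariance operators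
`A_{B_μ} = n²(−Δ_{T_η… in lattice steps}) + a·n^d(bondAvg μ)ᵀ(bondAvg μ)` = `covOp n M (bondAvg n M μ) a (n²) 0`
(King scaling, massless, the SAME `a`), as a complex matrix on vector functions. [folklore] -/
def covSum (a : ℝ) : Matrix (Tor (fine n M) × Fin d) (Tor (fine n M) × Fin d) ℂ :=
  Matrix.blockDiagonal fun μ => (covOp n M (bondAvg n M μ) a ((n : ℝ) ^ 2) 0).map Complex.ofRealHom

omit [NeZero n] hM in
/-- `(r • G).map (ℝ → ℂ) = r • G.map (ℝ → ℂ)`. [folklore] -/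
theorem map_smul_ofReal {m k : Type*} (r : ℝ) (G : Matrix m k ℝ) :
    (r • G).map Complex.ofRealHom = (r : ℂ) • G.map Complex.ofRealHom := by
  ext i j
  simp only [Matrix.map_apply, Matrix.smul_apply, smul_eq_mul, Complex.ofRealHom_eq_coe, Complex.ofReal_mul]

/-- **DICTIONARY ROW (D1). B5's `Δ + aQ*_kQ_k` ((1.69) at `U = 1`, any `d`, any periods, `a` real) IS the direct
sum over the component index `μ` of the bond covariance operators of `Beta.WoodburyCovariant` §10:
`Lap + a·QvAdj·QvOp = ⊕_μ covOp(bondAvg μ, a, c = n², m² = 0)` — EXACTLY, entry by entry.** [folklore] -/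
theorem Lap_add_QQ_eq_covSum (a : ℝ) :
    Lap n M + (a : ℂ) • (QvAdj n M * QvOp n M) = covSum n M a := by
  rw [covSum, Lap_eq_blockDiagonal, QvAdj_mul_QvOp_eq_blockDiagonal]
  have e : (fun μ : Fin d => (covOp n M (bondAvg n M μ) a ((n : ℝ) ^ 2) 0).map Complex.ofRealHom)
      = (fun _ : Fin d => (lapF (fine n M) ((n : ℝ) ^ 2) 0).map Complex.ofRealHom)
        + (a : ℂ) • (fun μ : Fin d => (gram n M (bondAvg n M μ)).map Complex.ofRealHom) := by
    funext μ
    rw [Pi.add_apply, Pi.smul_apply, covOp, Matrix.map_add _ (map_add Complex.ofRealHom), map_smul_ofReal]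
  rw [e, Matrix.blockDiagonal_add, Matrix.blockDiagonal_smul]

/-- **DICTIONARY ROW (D2). `Δ_a = ⊕_μ A_{B_μ} − ∂P∂*`**: the lineage's position-space `DeltaA` ((1.69)/(1.73):
`Δ − ∂P∂* + aQ*Q`, `P = PcT` the projection of (1.26)) differs from the direct sum EXACTLY by the gauge-fixing
projection term `∂·P·∂*` — the coupling of the components is through `P` and nothing else.
[cite: Balaban1984PropagatorsI, (1.69) p.29] -/
theorem DeltaA_eq_covSum_sub (a : ℝ) :
    DeltaA n M a = covSum n M a - GradOp (fine n M) (n : ℂ) * PcT n M (n : ℂ) * (GradOp (fine n M) (n : ℂ))ᴴ := by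
  rw [← Lap_add_QQ_eq_covSum, DeltaA]
  abel

end DirectSum

/-! ## §3 `(⊕_μ A_{B_μ})⁻¹ = ⊕_μ Γ_μ`: the massless endpoint decomposition (P0₀), component by component -/

section Inverse

variable {d : ℕ} (n : ℕ) [NeZero n] (hn : 1 ≤ n) (M : Fin d → ℕ) [hM : ∀ μ, NeZero (M μ)] (a : ℝ)
  (ha : 0 < a)

/-- THE DIRECT SUM `⊕_μ Γ_μ` of an5-g6's massless-endpoint kernels
`Γ_μ = Gdec_{w_μ}(0) = G_free,0^⊥ + |𝕋|⁻¹a⁻¹ − R^⊥_{w_μ,0}`, `w_μ = wt (bondAvg μ)` (`= u·v_μ` on the fibre,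
`Beta.WoodburyCovariant.wt_bondAvg_pOf`). [folklore] -/
def gammaSum : Matrix (Tor (fine n M) × Fin d) (Tor (fine n M) × Fin d) ℂ :=
  Matrix.blockDiagonal fun μ => GdecW n M (wt n M (bondAvg n M μ)) a 0

/-- entries of `⊕_μ Γ_μ`: `δ_{μν}·(G_free,0^⊥(x′−x) + |𝕋|⁻¹a⁻¹ − R^⊥_{w_μ,0}(x,x′))`. [folklore] -/
theorem gammaSum_apply (x x' : Tor (fine n M)) (μ ν : Fin d) :
    gammaSum n M a (x, μ) (x', ν)
      = if μ = ν then
          GfreePerp n M 0 (x' - x) + ((Fintype.card (Tor (fine n M)) : ℂ))⁻¹ * (1 / (a : ℂ))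
            - RperpW n M (wt n M (bondAvg n M μ)) a 0 x x'
        else 0 := by
  rw [gammaSum, Matrix.blockDiagonal_apply']
  by_cases h : μ = ν
  · simp only [if_pos h, GdecW, Complex.ofReal_zero, zero_add]
  · rw [if_neg h, if_neg h]

include hn ha in
/-- `(⊕_μ Γ_μ)·(⊕_μ A_{B_μ}) = 1` — `Beta.WoodburyCovariant.GdecW_mul_covOp_zero` BY NAME, block by block
(its hypotheses: `covariant_bondAvg`, `admissible_bondAvg`, `1 ≤ n`, `0 < a`). [folklore] -/
theorem gammaSum_mul_covSum : gammaSum n M a * covSum n M a = 1 := by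
  rw [gammaSum, covSum, ← Matrix.blockDiagonal_mul, ← Matrix.blockDiagonal_one]
  congr 1
  funext μ
  exact GdecW_mul_covOp_zero n M (covariant_bondAvg n M μ) (admissible_bondAvg n M hn μ) hn ha

include hn ha in
/-- `(⊕_μ A_{B_μ})·(⊕_μ Γ_μ) = 1`. [folklore] -/
theorem covSum_mul_gammaSum : covSum n M a * gammaSum n M a = 1 :=
  mul_eq_one_comm.mp (gammaSum_mul_covSum n hn M a ha)

include hn ha in
/-- `⊕_μ A_{B_μ}` is invertible (`a > 0`, `n ≥ 1`). [folklore] -/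
theorem isUnit_covSum : IsUnit (covSum n M a) :=
  (Matrix.isUnit_iff_isUnit_det _).mpr (Matrix.isUnit_det_of_left_inverse (gammaSum_mul_covSum n hn M a ha))

include hn ha in
/-- **DICTIONARY ROW (D3). `(Δ + aQ*_kQ_k)⁻¹ = (⊕_μ A_{B_μ})⁻¹ = ⊕_μ Γ_μ`**: the inverse of B5's `Δ + aQ*Q`
at `U = 1` is, component by component, the (P0₀)-decomposed massless-endpoint kernel of
`Beta.WoodburyCovariant` (`covOp_inv_zero_decomposition`): `G_free,0^⊥ + |𝕋|⁻¹a⁻¹ − R^⊥_{u·v_μ,0}`. [folklore] -/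
theorem inv_Lap_add_QQ :
    (Lap n M + (a : ℂ) • (QvAdj n M * QvOp n M))⁻¹ = gammaSum n M a := by
  rw [Lap_add_QQ_eq_covSum]
  exact Matrix.inv_eq_left_inv (gammaSum_mul_covSum n hn M a ha)

end Inverse

/-! ## §4 (1.55)/(1.20): `Q_k ∂ = ∂₁ Q′_k` as a matrix identity -/

section Averaging

variable {d : ℕ} (n : ℕ) [NeZero n] (M : Fin d → ℕ) [hM : ∀ μ, NeZero (M μ)]

/-- **DICTIONARY ROW (D5). (1.55) «Q_k(η ∂^{η,1}λ) = ∂^1 Q′_k(ηλ)», equivalently (1.20)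
«Q_kA^λ = (Q_kA)^{λ′}, λ′ = Q′_kλ», as the MATRIX identity `Q_k·∂_η = ∂₁·Q′_k`** (`∂_η = GradOp (fine n M) n`
on `T_η`, `∂₁ = GradOp M 1` on the unit lattice; from the lineage's `B5Block118.QvOp_gaugeT_eq`).
[cite: Balaban1984PropagatorsI, (1.20) p.20, (1.55) p.27] -/
theorem QvOp_mul_GradOp : QvOp n M * GradOp (fine n M) (n : ℂ) = GradOp M 1 * QsOp n M := by
  refine ext_of_mulVec' fun l => ?_
  rw [← Matrix.mulVec_mulVec, ← Matrix.mulVec_mulVec]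
  have h := QvOp_gaugeT_eq n M 0 l
  rw [gaugeT, zero_sub, Matrix.mulVec_neg, Matrix.mulVec_zero, zero_sub, neg_inj] at h
  exact h

end Averaging

/-! ## §5 `G_k(U = 1) = Δ_a⁻¹` against `⊕_μ Γ_μ`: the longitudinal coupling through `∂P`, exactly -/

section Longitudinal

variable {d : ℕ} (n : ℕ) [NeZero n] (hn : 1 ≤ n) (M : Fin d → ℕ) [hM : ∀ μ, NeZero (M μ)] (a : ℝ)
  (ha : 0 < a)

/-- `∂P`: the gradient composed with the projection `P = Δ⁻¹Q′*_k(Q′_kΔ⁻²Q′*_k)⁻¹Q′_kΔ⁻¹` of (1.26)/(1.70)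
(`B5Value126.PcT`), a map (scalar functions on `T_η`) → (vector functions on `T_η`).
[cite: Balaban1984PropagatorsI, (1.26) p.22, (1.70) p.30] -/
def dP : Matrix (Tor (fine n M) × Fin d) (Tor (fine n M)) ℂ := GradOp (fine n M) (n : ℂ) * PcT n M (n : ℂ)

/-- `∂P∂* = (∂P)(∂P)*` because `P* = P = P²` ((1.26)–(1.28): `P` and `I − P` are orthogonal projections;
`B5Value126.PcT_conjTranspose`, `PcT_mul_PcT`). [cite: Balaban1984PropagatorsI, (1.28) p.22] -/
theorem dP_mul_conjTranspose :
    dP n M * (dP n M)ᴴ = GradOp (fine n M) (n : ℂ) * PcT n M (n : ℂ) * (GradOp (fine n M) (n : ℂ))ᴴ := by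
  have hc : (n : ℂ) ≠ 0 := Nat.cast_ne_zero.mpr (NeZero.ne n)
  rw [dP, Matrix.conjTranspose_mul, PcT_conjTranspose, Matrix.mul_assoc,
    ← Matrix.mul_assoc (PcT n M (n : ℂ)) (PcT n M (n : ℂ)), PcT_mul_PcT n M (n : ℂ) hc, Matrix.mul_assoc]

/-- **`Δ_a = ⊕_μ A_{B_μ} − (∂P)(∂P)*`.** [cite: Balaban1984PropagatorsI, (1.69) p.29] -/
theorem DeltaA_eq_covSum_sub_dP : DeltaA n M a = covSum n M a - dP n M * (dP n M)ᴴ := by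
  rw [dP_mul_conjTranspose, DeltaA_eq_covSum_sub]

include hn ha in
/-- `Δ_a·(⊕_μ Γ_μ) = 1 − (∂P)(∂P)*(⊕_μ Γ_μ)`: `⊕_μ Γ_μ` inverts `Δ_a` up to the longitudinal term, exactly. [folklore] -/
theorem DeltaA_mul_gammaSum :
    DeltaA n M a * gammaSum n M a = 1 - dP n M * (dP n M)ᴴ * gammaSum n M a := by
  rw [DeltaA_eq_covSum_sub_dP, Matrix.sub_mul, covSum_mul_gammaSum n hn M a ha]

include hn ha in
/-- `(⊕_μ Γ_μ)·Δ_a = 1 − (⊕_μ Γ_μ)(∂P)(∂P)*`. [folklore] -/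
theorem gammaSum_mul_DeltaA :
    gammaSum n M a * DeltaA n M a = 1 - gammaSum n M a * dP n M * (dP n M)ᴴ := by
  rw [DeltaA_eq_covSum_sub_dP, Matrix.mul_sub, gammaSum_mul_covSum n hn M a ha, Matrix.mul_assoc]

/-- **DICTIONARY ROW (D4), resolvent form. Bałaban's `G_k(U=1) = 𝒢 = Δ_a⁻¹` (the lineage's `calG`,
(1.71)/(1.83)) and the direct sum of an5-g6's kernels satisfy the EXACT second resolvent identity
`𝒢 = ⊕_μ Γ_μ + 𝒢·(∂P)(∂P)*·(⊕_μ Γ_μ)`**: the componentwise ("diagonal") part of `G_k(U=1)` IS `⊕_μ Γ_μ`, and the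
whole coupling between components is the longitudinal term through the gauge-fixing projection `P`.  No bound on
that term is asserted here.  [cite: Balaban1984PropagatorsI, (1.71) p.30, (1.83) p.31 (proof ours)] -/
theorem calG_eq_gammaSum_add_resolvent :
    calG n hn M a ha = gammaSum n M a + calG n hn M a ha * (dP n M * (dP n M)ᴴ) * gammaSum n M a := by
  have h1 : calG n hn M a ha * (DeltaA n M a * gammaSum n M a) = gammaSum n M a := by
    rw [← Matrix.mul_assoc, calG_mul_DeltaA n hn M a ha, Matrix.one_mul]
  rw [DeltaA_mul_gammaSum n hn M a ha, Matrix.mul_sub, Matrix.mul_one] at h1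
  have h2 := (sub_eq_iff_eq_add).mp h1
  simpa only [Matrix.mul_assoc] using h2

/-- the same identity from the other side: `𝒢 = ⊕_μ Γ_μ + (⊕_μ Γ_μ)·(∂P)(∂P)*·𝒢`. [folklore] -/
theorem calG_eq_gammaSum_add_resolvent' :
    calG n hn M a ha = gammaSum n M a + gammaSum n M a * (dP n M * (dP n M)ᴴ) * calG n hn M a ha := by
  have h1 : (gammaSum n M a * DeltaA n M a) * calG n hn M a ha = gammaSum n M a := by
    rw [Matrix.mul_assoc, DeltaA_mul_calG n hn M a ha, Matrix.mul_one]
  rw [gammaSum_mul_DeltaA n hn M a ha, Matrix.sub_mul, Matrix.one_mul] at h1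
  have h2 := (sub_eq_iff_eq_add).mp h1
  simpa only [Matrix.mul_assoc] using h2

/-- the CAPACITANCE matrix `1 − (∂P)*(⊕_μ Γ_μ)(∂P)` on scalar functions. [folklore] -/
def capacitance : Matrix (Tor (fine n M)) (Tor (fine n M)) ℂ :=
  1 - (dP n M)ᴴ * gammaSum n M a * dP n M

include hn ha in
/-- `Δ_a = (⊕_μ A_{B_μ})·(1 − (⊕Γ)(∂P)(∂P)*)`. [folklore] -/
theorem DeltaA_eq_factor :
    DeltaA n M a = covSum n M a * (1 - gammaSum n M a * dP n M * (dP n M)ᴴ) := by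
  rw [Matrix.mul_sub, Matrix.mul_one, ← Matrix.mul_assoc, ← Matrix.mul_assoc,
    covSum_mul_gammaSum n hn M a ha, Matrix.one_mul, DeltaA_eq_covSum_sub_dP]

include hn ha in
/-- the capacitance matrix is invertible: `det Δ_a = det(1 − (∂P)*(⊕Γ)(∂P))·det(⊕_μ A_{B_μ})` (Sylvester) and
`Δ_a` is invertible (`B5DeltaA169.isUnit_DeltaA`). [folklore] -/
theorem isUnit_capacitance : IsUnit (capacitance n M a) := by
  rw [Matrix.isUnit_iff_isUnit_det, capacitance, Matrix.mul_assoc, Matrix.det_one_sub_mul_comm]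
  have h := (Matrix.isUnit_iff_isUnit_det _).mp (isUnit_DeltaA n hn M a ha)
  rw [DeltaA_eq_factor n hn M a ha, Matrix.det_mul] at h
  exact isUnit_of_mul_isUnit_right h

include hn ha in
/-- **DICTIONARY ROW (D4), closed (Woodbury) form: `G_k(U=1) = ⊕_μ Γ_μ + (⊕Γ)(∂P)·(1 − (∂P)*(⊕Γ)(∂P))⁻¹·(∂P)*(⊕Γ)`**
— the inverse of `Δ_a = ⊕_μ A_{B_μ} − (∂P)(∂P)*` by the Woodbury identity (`Matrix.add_mul_mul_inv_eq_sub` with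
`C = −1`), all inverses certified to exist.  [folklore] -/
theorem calG_eq_gammaSum_add_woodbury :
    calG n hn M a ha
      = gammaSum n M a
        + gammaSum n M a * dP n M * (capacitance n M a)⁻¹ * (dP n M)ᴴ * gammaSum n M a := by
  have hA := isUnit_covSum n hn M a ha
  have hΓ : (covSum n M a)⁻¹ = gammaSum n M a := Matrix.inv_eq_left_inv (gammaSum_mul_covSum n hn M a ha)
  have hC : IsUnit (-1 : Matrix (Tor (fine n M)) (Tor (fine n M)) ℂ) := isUnit_one.neg
  have hCinv : (-1 : Matrix (Tor (fine n M)) (Tor (fine n M)) ℂ)⁻¹ = -1 :=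
    Matrix.inv_eq_left_inv (by rw [neg_mul_neg, Matrix.one_mul])
  have hK : (-1 : Matrix (Tor (fine n M)) (Tor (fine n M)) ℂ)⁻¹ + (dP n M)ᴴ * (covSum n M a)⁻¹ * dP n M
      = -capacitance n M a := by
    rw [hCinv, hΓ, capacitance, neg_sub, sub_eq_neg_add]
  have hKu : IsUnit ((-1 : Matrix (Tor (fine n M)) (Tor (fine n M)) ℂ)⁻¹
      + (dP n M)ᴴ * (covSum n M a)⁻¹ * dP n M) := by
    rw [hK]
    exact (isUnit_capacitance n hn M a ha).neg
  have hKinv : (-capacitance n M a)⁻¹ = -(capacitance n M a)⁻¹ := by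
    refine Matrix.inv_eq_left_inv ?_
    rw [neg_mul_neg, Matrix.nonsing_inv_mul _
      ((Matrix.isUnit_iff_isUnit_det _).mp (isUnit_capacitance n hn M a ha))]
  have hform : DeltaA n M a
      = covSum n M a + dP n M * (-1 : Matrix (Tor (fine n M)) (Tor (fine n M)) ℂ) * (dP n M)ᴴ := by
    rw [DeltaA_eq_covSum_sub_dP, Matrix.mul_neg, Matrix.mul_one, Matrix.neg_mul, sub_eq_add_neg]
  rw [calG_eq_DeltaA_inv, hform, Matrix.add_mul_mul_inv_eq_sub (covSum n M a) (dP n M) (-1) (dP n M)ᴴ hA hC hKu, hK, hKinv, hΓ]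
  simp only [Matrix.mul_neg, Matrix.neg_mul, sub_neg_eq_add]

end Longitudinal

/-! ## §6 In momentum space, on the alias fibres `p = p′ + l`: the Fourier blocks of `⊕_μ A_{B_μ}`, of `⊕_μ Γ_μ`,
and of the longitudinal term — lines 1–2 resp. line 3 of (1.83) -/

section Fourier

variable {d : ℕ} (n : ℕ) [NeZero n] (hn : 1 ≤ n) (M : Fin d → ℕ) [hM : ∀ μ, NeZero (M μ)] (a : ℝ)
  (ha : 0 < a)

/-- pass 5's `D = Δ + aQ*Q` on a fibre is `lapV + a·(Qv)ᴴQv` (`Da = lapV − ∂P∂* + aQᴴQ`, `Da = D − X⁻¹qq^*`,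
`∂P∂* = X⁻¹qq^*`). [folklore] -/
theorem Da_add_dPd {Λ : Type*} [Fintype Λ] [DecidableEq Λ] (F : B5Prop11Bound.Fiber Λ d) :
    Da F + dOp F * B5Prop11Inverse.Pproj F * (dOp F)ᴴ = Dmat F := by
  have h := Da_eq F
  rw [dPd_eq]
  rw [h, sub_add_cancel]

/-- `⊕_μ A_{B_μ} A = ΔA + a·η^{-d}(Q_k)ᴴQ_kA`. [folklore] -/
theorem covSum_eq_DeltaA_add :
    covSum n M a = DeltaA n M a + GradOp (fine n M) (n : ℂ) * PcT n M (n : ℂ) * (GradOp (fine n M) (n : ℂ))ᴴ := by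
  rw [DeltaA_eq_covSum_sub, sub_add_cancel]

/-- THE FOURIER BLOCKS OF `⊕_μ A_{B_μ} = Δ + aQ*_kQ_k` over the cosets `p = p′ + l` (`p′ ∈ T₁`, `l ∈ (2πℤ/n)^d`):
at `p′ ≠ 0` pass 5's `Dmat` of the fibre — `⊕_μ (diag_l Δ(p′+l) + a·c_μc_μ^*)`, `c_μ(l) = conj(u(p′+l)v_μ(p′+l))`, i.e.
the block-diagonal-in-`μ` matrix built from the alias weight `u·v_μ` of (1.29)–(1.31)/(1.61) (= an5-g6's
`wt (bondAvg μ)` on the fibre, `Beta.WoodburyCovariant.wt_bondAvg_pOf`); at `p′ = 0` the lineage's zero fibre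
`DaBlocks 0 = Da₀ = diag(Δ(l) + a[l = 0])`. [cite: Balaban1984PropagatorsI, (1.29)-(1.31) p.23, (1.61) p.28, (1.73) p.30] -/
def MBlocks (q : Tor M) : Matrix ((Fin d → Fin n) × Fin d) ((Fin d → Fin n) × Fin d) ℂ :=
  if h : q = 0 then DaBlocks n hn M a ha 0 else Dmat (B5FiberQQ.fiberAt n M hn a ha q h)

/-- `p′ ≠ 0`: the block is `Dmat (fiberAt p′)`. [folklore] -/
theorem MBlocks_of_ne {q : Tor M} (hq : q ≠ 0) :
    MBlocks n hn M a ha q = Dmat (B5FiberQQ.fiberAt n M hn a ha q hq) := by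
  rw [MBlocks, dif_neg hq]

/-- `p′ = 0`: the block is the zero fibre `DaBlocks 0` (`= Da₀`, `B5DeltaA169.DaBlocks_zero`). [folklore] -/
theorem MBlocks_zero : MBlocks n hn M a ha 0 = DaBlocks n hn M a ha 0 := by
  rw [MBlocks, dif_pos rfl]

/-- the fibre of `⊕_μ A_{B_μ}` at `p′ ≠ 0`. [folklore] -/
theorem fiber_covSum_of_ne (A : Tor (fine n M) × Fin d → ℂ) (k : Fin d → Fin n) {q : Tor M} (hq : q ≠ 0)
    (κ : Fin d) :
    (dftV (fine n M) *ᵥ (covSum n M a *ᵥ A)) (pOf n M (k, q), κ)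
      = (MBlocks n hn M a ha q *ᵥ fun j => (dftV (fine n M) *ᵥ A) (pOf n M (j.1, q), j.2)) (k, κ) := by
  rw [MBlocks_of_ne n hn M a ha hq, covSum_eq_DeltaA_add, Matrix.add_mulVec, Matrix.mulVec_add, Pi.add_apply,
    fiber_DeltaA_of_ne n hn M a ha A k hq κ, DaBlocks_of_ne n hn M a ha hq, ← Matrix.mulVec_mulVec,
    ← Matrix.mulVec_mulVec, fiber_dPd_term n hn M a ha A k hq κ, ← Pi.add_apply, ← Matrix.add_mulVec,
    Da_add_dPd]

/-- the fibre of `⊕_μ A_{B_μ}` at `p′ = 0` (the `∂P∂*` term has no zero fibre, `B5DeltaA169.fiber_dPd_term_zero`).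
[folklore] -/
theorem fiber_covSum_zero (A : Tor (fine n M) × Fin d → ℂ) (k : Fin d → Fin n) (κ : Fin d) :
    (dftV (fine n M) *ᵥ (covSum n M a *ᵥ A)) (pOf n M (k, 0), κ)
      = (MBlocks n hn M a ha 0 *ᵥ fun j => (dftV (fine n M) *ᵥ A) (pOf n M (j.1, 0), j.2)) (k, κ) := by
  rw [MBlocks_zero, covSum_eq_DeltaA_add, Matrix.add_mulVec, Matrix.mulVec_add, Pi.add_apply,
    fiber_DeltaA_zero n hn M a ha A k κ, ← Matrix.mulVec_mulVec, ← Matrix.mulVec_mulVec,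
    fiber_dPd_term_zero n M A k κ, add_zero]

/-- the fibre decomposition of `⊕_μ A_{B_μ}`, all cosets. [folklore] -/
theorem fiber_covSum (A : Tor (fine n M) × Fin d → ℂ) (k : Fin d → Fin n) (q : Tor M) (κ : Fin d) :
    (dftV (fine n M) *ᵥ (covSum n M a *ᵥ A)) (pOf n M (k, q), κ)
      = (MBlocks n hn M a ha q *ᵥ fun j => (dftV (fine n M) *ᵥ A) (pOf n M (j.1, q), j.2)) (k, κ) := by
  by_cases hq : q = 0
  · subst hq
    exact fiber_covSum_zero n hn M a ha A k κ
  · exact fiber_covSum_of_ne n hn M a ha A k hq κ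

/-- `𝓜̂`: the block family `MBlocks` transported to (fine momentum, component) indices. [folklore] -/
def calMhat : Matrix (Tor (fine n M) × Fin d) (Tor (fine n M) × Fin d) ℂ :=
  (Matrix.reindex (blockEquiv n M) (blockEquiv n M)).symm (Matrix.blockDiagonal (MBlocks n hn M a ha))

/-- `U (⊕_μ A_{B_μ}) A = 𝓜̂ U A`. [folklore] -/
theorem dftV_covSum_mulVec (A : Tor (fine n M) × Fin d → ℂ) :
    dftV (fine n M) *ᵥ (covSum n M a *ᵥ A) = calMhat n hn M a ha *ᵥ (dftV (fine n M) *ᵥ A) := by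
  funext I
  obtain ⟨J, rfl⟩ := (blockEquiv n M).symm.surjective I
  obtain ⟨⟨k, κ⟩, q⟩ := J
  rw [blockEquiv_symm_apply, calMhat, blockOp_mulVec, emb_eq, fiber_covSum n hn M a ha]
  simp only [Matrix.mulVec, dotProduct]
  refine Finset.sum_congr rfl fun j _ => ?_
  rfl

/-- `U (⊕_μ A_{B_μ}) = 𝓜̂ U`. [folklore] -/
theorem dftV_mul_covSum : dftV (fine n M) * covSum n M a = calMhat n hn M a ha * dftV (fine n M) :=
  ext_of_mulVec fun A => by
    rw [← Matrix.mulVec_mulVec, ← Matrix.mulVec_mulVec, dftV_covSum_mulVec n hn M a ha]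

/-- **`⊕_μ A_{B_μ} = U^* 𝓜̂ U`: in momentum space `Δ + aQ*_kQ_k` is block-diagonal over the cosets with blocks
`Dmat (fiberAt p′)` / `Da₀`.** [folklore] -/
theorem covSum_eq_conj : covSum n M a = star (dftV (fine n M)) * calMhat n hn M a ha * dftV (fine n M) := by
  rw [Matrix.mul_assoc, ← dftV_mul_covSum n hn M a ha, ← Matrix.mul_assoc, star_dftV_mul, Matrix.one_mul]

/-- THE FOURIER BLOCKS OF `⊕_μ Γ_μ`: at `p′ ≠ 0` pass 5's `Omat` of the fibre = LINES 1–2 OF (1.83),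
`⊕_μ [Δ(p′+l)⁻¹δ_{ll′} − a·φ_μ(p′)⁻¹ x_μ(l) conj x_μ(l′)]`, `x_μ(l) = conj(u v_μ)(p′+l)/Δ(p′+l)`,
`φ_μ = 1 + aΣ_l |uv_μ|²(p′+l)/Δ(p′+l)`; at `p′ = 0` the lineage's zero block `blocks 0 = G₀`.
[cite: Balaban1984PropagatorsI, (1.83) p.31 (lines 1-2)] -/
def OBlocks (q : Tor M) : Matrix ((Fin d → Fin n) × Fin d) ((Fin d → Fin n) × Fin d) ℂ :=
  if h : q = 0 then blocks n hn M a ha 0 else Omat (B5FiberQQ.fiberAt n M hn a ha q h)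

/-- block by block `𝓜(p′)·O(p′) = 1` (pass 5's Sherman–Morrison `Dmat_mul_Omat`; `DaBlocks_mul_blocks` at `p′ = 0`).
[folklore] -/
theorem MBlocks_mul_OBlocks (q : Tor M) : MBlocks n hn M a ha q * OBlocks n hn M a ha q = 1 := by
  by_cases hq : q = 0
  · subst hq
    rw [MBlocks_zero, OBlocks, dif_pos rfl]
    exact DaBlocks_mul_blocks n hn M a ha 0
  · rw [MBlocks_of_ne n hn M a ha hq, OBlocks, dif_neg hq]
    exact Dmat_mul_Omat _

/-- `𝓞̂`: the block family `OBlocks` transported. [folklore] -/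
def calOhat : Matrix (Tor (fine n M) × Fin d) (Tor (fine n M) × Fin d) ℂ :=
  (Matrix.reindex (blockEquiv n M) (blockEquiv n M)).symm (Matrix.blockDiagonal (OBlocks n hn M a ha))

/-- `𝓜̂ 𝓞̂ = 1`. [folklore] -/
theorem calMhat_mul_calOhat : calMhat n hn M a ha * calOhat n hn M a ha = 1 := by
  rw [calMhat, calOhat, Matrix.reindex_symm, Matrix.reindex_apply, Matrix.reindex_apply,
    Equiv.symm_symm, Matrix.submatrix_mul_equiv, ← Matrix.blockDiagonal_mul]
  have h : (fun q => MBlocks n hn M a ha q * OBlocks n hn M a ha q) = 1 :=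
    funext fun q => MBlocks_mul_OBlocks n hn M a ha q
  rw [h, Matrix.blockDiagonal_one, Matrix.submatrix_one_equiv]

/-- **`⊕_μ Γ_μ = U^* 𝓞̂ U`: the Fourier blocks of the direct sum of an5-g6's kernels ARE lines 1–2 of (1.83)
(`Omat` of the fibre) at `p′ ≠ 0` and `G₀` at `p′ = 0`.** [cite: Balaban1984PropagatorsI, (1.83) p.31 (proof ours)] -/
theorem gammaSum_eq_conj : gammaSum n M a = star (dftV (fine n M)) * calOhat n hn M a ha * dftV (fine n M) := by
  have hU : dftV (fine n M) * star (dftV (fine n M)) = 1 := dftV_mul_star (fine n M)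
  have h1 : covSum n M a * (star (dftV (fine n M)) * calOhat n hn M a ha * dftV (fine n M)) = 1 := by
    rw [covSum_eq_conj n hn M a ha]
    calc star (dftV (fine n M)) * calMhat n hn M a ha * dftV (fine n M)
          * (star (dftV (fine n M)) * calOhat n hn M a ha * dftV (fine n M))
          = star (dftV (fine n M)) * (calMhat n hn M a ha * (dftV (fine n M) * star (dftV (fine n M)))
              * calOhat n hn M a ha) * dftV (fine n M) := by
            simp only [Matrix.mul_assoc]
      _ = 1 := by
            rw [hU, Matrix.mul_one, calMhat_mul_calOhat, Matrix.mul_one, star_dftV_mul]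
  rw [← Matrix.inv_eq_right_inv h1]
  exact (Matrix.inv_eq_left_inv (gammaSum_mul_covSum n hn M a ha)).symm

/-- THE FOURIER BLOCKS OF THE LONGITUDINAL TERM = LINE 3 OF (1.83): `a⁻¹Φ(p′)⁻¹ b(p′) b(p′)^*`, rank one per
fibre, with `b(l,μ)` the square bracket of (1.83) (pass 5's `bv`, `cT = a⁻¹Φ⁻¹`); zero at `p′ = 0`.
[cite: Balaban1984PropagatorsI, (1.83) p.31 (line 3)] -/
def LBlocks (q : Tor M) : Matrix ((Fin d → Fin n) × Fin d) ((Fin d → Fin n) × Fin d) ℂ :=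
  if h : q = 0 then 0
  else (B5FiberQQ.fiberAt n M hn a ha q h).cT
    • Matrix.vecMulVec (bv (B5FiberQQ.fiberAt n M hn a ha q h)) (star (bv (B5FiberQQ.fiberAt n M hn a ha q h)))

/-- (1.83) = lines 1–2 + line 3, block by block (pass 5's `G_eq`; nothing to split at `p′ = 0`). [folklore] -/
theorem blocks_eq_OBlocks_add_LBlocks (q : Tor M) :
    blocks n hn M a ha q = OBlocks n hn M a ha q + LBlocks n hn M a ha q := by
  by_cases hq : q = 0
  · subst hq
    rw [OBlocks, LBlocks, dif_pos rfl, dif_pos rfl, add_zero]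
  · rw [OBlocks, LBlocks, dif_neg hq, dif_neg hq, blocks, dif_neg hq]
    exact G_eq _

/-- `𝓛̂`: the longitudinal block family transported. [folklore] -/
def calLhat : Matrix (Tor (fine n M) × Fin d) (Tor (fine n M) × Fin d) ℂ :=
  (Matrix.reindex (blockEquiv n M) (blockEquiv n M)).symm (Matrix.blockDiagonal (LBlocks n hn M a ha))

/-- `Ĝ = 𝓞̂ + 𝓛̂`. [folklore] -/
theorem calGhat_eq : calGhat n hn M a ha = calOhat n hn M a ha + calLhat n hn M a ha := by
  have h : blocks n hn M a ha = OBlocks n hn M a ha + LBlocks n hn M a ha :=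
    funext fun q => blocks_eq_OBlocks_add_LBlocks n hn M a ha q
  rw [calGhat, h, Matrix.blockDiagonal_add, calOhat, calLhat]
  simp only [Matrix.reindex_symm, Matrix.reindex_apply, Matrix.submatrix_add, Equiv.symm_symm]
  rfl

/-- **DICTIONARY ROW (D6). `G_k(U=1) = ⊕_μ Γ_μ + U^*(⊕_{p′≠0} a⁻¹Φ(p′)⁻¹ b(p′)b(p′)^*)U`**: Bałaban's covariant
propagator (1.83) at `U = 1` IS the direct sum of an5-g6's (P0₀)-decomposed kernels (its Fourier blocks are
lines 1–2 of (1.83)) PLUS the rank-one-per-fibre longitudinal term of line 3 of (1.83) — exactly, as matrices on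
`ℓ²(T_η; ℂ^d)`.  No bound on the longitudinal term is asserted here.
[cite: Balaban1984PropagatorsI, (1.83) p.31 (proof ours)] -/
theorem calG_eq_gammaSum_add_longitudinal :
    calG n hn M a ha = gammaSum n M a + star (dftV (fine n M)) * calLhat n hn M a ha * dftV (fine n M) := by
  rw [calG, calGhat_eq, Matrix.mul_add, Matrix.add_mul, ← gammaSum_eq_conj n hn M a ha]

/-- the two descriptions of the longitudinal term agree: Woodbury through `∂P` (§5) = line 3 of (1.83) (§6).
[folklore] -/
theorem longitudinal_eq :
    gammaSum n M a * dP n M * (capacitance n M a)⁻¹ * (dP n M)ᴴ * gammaSum n M a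
      = star (dftV (fine n M)) * calLhat n hn M a ha * dftV (fine n M) := by
  have h1 := calG_eq_gammaSum_add_woodbury n hn M a ha
  have h2 := calG_eq_gammaSum_add_longitudinal n hn M a ha
  exact (add_right_inj _).mp (h1.symm.trans h2)

end Fourier

end Literature.MathematicalPhysics.QuantumFieldTheory.Balaban1983to89.Beta.VectorPropagatorDict

end
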